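import Mathlib
import Literature.Computability.AlgebraicComplexity.Apolarity
import Literature.Computability.AlgebraicComplexity.ApolarityAction
import Literature.Computability.AlgebraicComplexity.LinSubst
import Summits.ValiantsHypothesis.ValiantsHypothesis.Theorems.BorderApolarityFixedWitnessObstructionQPKuratowskiSubmodule
import Summits.ValiantsHypothesis.ValiantsHypothesis.Theorems.BorderApolarityFixedWitnessObstructionQPAnnSubmodule
import Summits.ValiantsHypothesis.ValiantsHypothesis.Theorems.BorderApolarityToricFixedPointsCellRetractionAux2

/-!
# Border apolarity, crux `ToricFixedPoints` — cell closure at isolated fixed points (S4, isolated)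

Route `ValiantsHypothesis/BorderApolarity`, crux item `stmt-ValiantsHypothesis-5779`
(`Summit.ValiantsHypothesis.ValiantsHypothesis.Theses.BorderApolarity.ToricFixedPoints`), line
`bb-cell-state-polytope`, stub `stub_cellClosure_isolated` (registered sub-goal of S4
`stub_cellClosure` of the lead's skeleton): S4 at ISOLATED fixed points of the torus action.

Setting.  `P'_t ∈ GL_{m²} · det_m`, `Ann_•(P'_t) → J` degree-wise (`IsBorderApolarLimit m P' J`),
`J` is `μ`-graded for a cocharacter `μ : σ → ℤ` (`σ = Fin m × Fin m`) and the `μ`-filtration ranks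
`dim (Ann_k(P'_t) ∩ S_{≥ν})` are pinned to those of `J k`.  The extra hypothesis (TOT) — `μ` is a
TOTAL order on the degree-`k` exponents for every `k ≤ m` (distinct exponents have distinct weights)
— is what "generic `μ` at an isolated fixed point" amounts to.  Conclusion (S4's, verbatim): `J` is
toric, i.e. there are `u, g ∈ GL` and weights `w` with
`J k = {D | uᵀ · D ∈ in_w(Ann_k(g · det_m))}` for all `k ≤ m`, `in_w` the span of the lowest-`w`-weight
forms.  We take `u = 1`, `g` with `P'_0 = g · det_m` ((ORB) at `t = 0`) and `w = μ`, so the claim is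
`J k = in_μ(Ann_k(P'_0))`.

Proof (`cci_core`, degree by degree; `A := Ann_k(P'_0)`, `π_ν := weightedHomogeneousComponent μ ν`,
`S_{≥ν}` the filtration pieces of `…CellRetractionAux2`).
1. `A`, `J k` are subspaces of the degree-`k` forms (`exists_annSubmodule`,
   `exists_submodule_coe_eq`) and the rank hypothesis at `t = 0` reads
   `dim (A ⊓ S_{≥ν}) = dim (J k ⊓ S_{≥ν})` for all `ν`; by rank–nullity and
   `S_{≥ν} ⊓ ker π_ν = S_{≥ν+1}` (`cr_filt_inf_ker`) the graded pieces `π_ν(A ⊓ S_{≥ν})` and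
   `π_ν(J k ⊓ S_{≥ν})` have the same dimension `r_ν - r_{ν+1}` (exactly as in `cr_core`).
2. (TOT): both graded pieces consist of degree-`k` forms of `μ`-weight `ν`, which are the multiples
   of one vector (`cci_exists_gen`: the monomial `x^{e_ν}` of the unique degree-`k` exponent of weight
   `ν`, or `0`); two equidimensional subspaces of a space of dimension `≤ 1` coincide
   (`cci_eq_of_finrank_eq`).  Hence `π_ν(A ⊓ S_{≥ν}) = π_ν(J k ⊓ S_{≥ν})` for every `ν`.
3. `in_μ(A) = Σ_ν π_ν(A ⊓ S_{≥ν})` (a lowest form of weight `ν` of `E ∈ A` is `π_ν E` with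
   `E ∈ S_{≥ν}`, and conversely) and, `J k` being graded, `J k = Σ_ν π_ν(J k ⊓ S_{≥ν})`
   (`D = Σ_ν π_ν D` over the finitely many weights of the monomials of `D`, `cr_sum_comp`).
Only `t = 0` of (ORB)/(RK) and the subspace/homogeneity consequences of (LIM) are used.
-/

open Filter Module
open scoped Topology

namespace Summit.ValiantsHypothesis.ValiantsHypothesis.Theorems.BorderApolarityToricFixedPoints

set_option linter.dupNamespace false

/-! ## Two linear-algebra helpers -/

section Helpers

open MvPolynomial

/-- Two subspaces of equal (finite) dimension inside a subspace of dimension `≤ 1` coincide: either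
both are `⊥` or both are the ambient line. [folklore] -/
theorem cci_eq_of_finrank_eq {V : Type*} [AddCommGroup V] [Module ℂ V]
    {L I N : Submodule ℂ V} [FiniteDimensional ℂ L] (hI : I ≤ L) (hN : N ≤ L)
    (hL : finrank ℂ L ≤ 1) (h : finrank ℂ I = finrank ℂ N) : I = N := by
  haveI : FiniteDimensional ℂ I := Submodule.finiteDimensional_of_le hI
  haveI : FiniteDimensional ℂ N := Submodule.finiteDimensional_of_le hN
  have hIL : finrank ℂ I ≤ finrank ℂ L := Submodule.finrank_mono hI
  rcases Nat.eq_zero_or_pos (finrank ℂ I) with h0 | hpos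
  · have hI0 : I = ⊥ := Submodule.finrank_eq_zero.1 h0
    have hN0 : N = ⊥ := Submodule.finrank_eq_zero.1 (h ▸ h0)
    rw [hI0, hN0]
  · have hIL' : I = L := Submodule.eq_of_le_of_finrank_eq hI (by omega)
    have hNL' : N = L := Submodule.eq_of_le_of_finrank_eq hN (by omega)
    rw [hIL', hNL']

/-- **(TOT) makes the weight spaces of degree-`k` forms at most one-dimensional.**  If distinct
degree-`k` exponents have distinct `μ`-weights, then for every weight `ν` the degree-`k` forms that
are `μ`-weighted-homogeneous of weight `ν` are the multiples of a single vector: the monomial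
`x^{e_ν}` of the unique degree-`k` exponent `e_ν` of weight `ν` if there is one, and `0` otherwise.
[folklore] -/
theorem cci_exists_gen {σ : Type*} (μ : σ → ℤ) (k : ℕ)
    (htot : ∀ e e' : σ →₀ ℕ, e.degree = k → e'.degree = k → e ≠ e' →
      Finsupp.weight μ e ≠ Finsupp.weight μ e') (ν : ℤ) :
    ∃ v : MvPolynomial σ ℂ, ∀ w : MvPolynomial σ ℂ, w.IsHomogeneous k →
      w.IsWeightedHomogeneous μ ν → ∃ c : ℂ, w = c • v := by
  classical
  by_cases hex : ∃ e : σ →₀ ℕ, e.degree = k ∧ Finsupp.weight μ e = ν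
  · obtain ⟨e, hek, heν⟩ := hex
    refine ⟨monomial e 1, fun w hwk hwν => ⟨coeff e w, ?_⟩⟩
    rw [smul_monomial, smul_eq_mul, mul_one]
    ext d
    rw [coeff_monomial]
    split_ifs with hde
    · rw [hde]
    · by_contra hne
      have hdk : d.degree = k := by
        by_contra h
        exact hne (hwk.coeff_eq_zero h)
      exact htot e d hek hdk hde (heν.trans (hwν hne).symm)
  · refine ⟨0, fun w hwk hwν => ⟨0, ?_⟩⟩
    rw [smul_zero]
    ext d
    rw [coeff_zero]
    by_contra hne
    have hdk : d.degree = k := by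
      by_contra h
      exact hne (hwk.coeff_eq_zero h)
    exact hex ⟨d, hdk, hwν hne⟩

end Helpers

/-! ## The core, degree by degree -/

section Main

open MvPolynomial
open Literature.Computability.AlgebraicComplexity
open Summit.ValiantsHypothesis.ValiantsHypothesis.Theorems.BorderApolarityFixedWitnessObstructionQP
  (exists_submodule_coe_eq exists_annSubmodule)

/-- **Core of `stub_cellClosure_isolated`, in degree `k ≤ m`.**  With `A = Ann_k(P'_0)`, `J k` the
Kuratowski limit of the `Ann_k(P'_t)`, `J k` `μ`-graded, (TOT) at degree `k`, and the filtration
ranks `dim (A ∩ S_{≥ν})` pinned to those of `J k`: `J k` is the initial span `in_μ(A)` (span of the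
lowest-`μ`-weight forms of elements of `A`).  The graded pieces `π_ν(A ∩ S_{≥ν})`, `π_ν(J k ∩ S_{≥ν})`
have equal dimension `r_ν - r_{ν+1}` (rank–nullity, `S_{≥ν} ⊓ ker π_ν = S_{≥ν+1}`) and lie in the
`≤ 1`-dimensional space of degree-`k` forms of weight `ν`, hence coincide; sum over `ν`. [folklore] -/
theorem cci_core (m : ℕ) (J : ℕ → Set (MvPolynomial (Fin m × Fin m) ℂ)) (μ : Fin m × Fin m → ℤ)
    (P' : ℕ → MvPolynomial (Fin m × Fin m) ℂ) (k : ℕ) (hk : k ≤ m)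
    (htot : ∀ e e' : (Fin m × Fin m) →₀ ℕ, e.degree = k → e'.degree = k → e ≠ e' →
      Finsupp.weight μ e ≠ Finsupp.weight μ e')
    (hlim : IsBorderApolarLimit m P' J)
    (hgr : ∀ D ∈ J k, ∀ ν : ℤ, weightedHomogeneousComponent μ ν D ∈ J k)
    (hrk : ∀ ν : ℤ,
      Module.finrank ℂ ↥(Submodule.span ℂ (annihilatorOfDegree (P' 0) k ∩
        {D : MvPolynomial (Fin m × Fin m) ℂ | ∀ e ∈ D.support, ν ≤ Finsupp.weight μ e})) =
      Module.finrank ℂ ↥(Submodule.span ℂ (J k ∩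
        {D : MvPolynomial (Fin m × Fin m) ℂ | ∀ e ∈ D.support, ν ≤ Finsupp.weight μ e})))
    (D : MvPolynomial (Fin m × Fin m) ℂ) :
    D ∈ J k ↔ D ∈ Submodule.span ℂ {D' : MvPolynomial (Fin m × Fin m) ℂ |
        ∃ E ∈ annihilatorOfDegree (P' 0) k, ∃ ν : ℤ, D' = weightedHomogeneousComponent μ ν E ∧
          ∀ ν' : ℤ, ν' < ν → weightedHomogeneousComponent μ ν' E = 0} := by
  classical
  -- the annihilators and the limit as submodules of the degree-`k` forms
  have hA := fun t => exists_annSubmodule k (P' t)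
  choose 𝒜 h𝒜 h𝒜hom _h𝒜dim using hA
  have hmemA : ∀ t D, D ∈ 𝒜 t ↔ D ∈ annihilatorOfDegree (P' t) k := fun t D => by
    rw [← SetLike.mem_coe, h𝒜]
  obtain ⟨𝒥, h𝒥⟩ := exists_submodule_coe_eq 𝒜 (J k)
    (fun D hD => by
      obtain ⟨Ds, hDs, hl⟩ := hlim.exists_tendsto hk hD
      exact ⟨Ds, fun t => (hmemA t _).2 (hDs t), hl⟩)
    (fun D φ Ds hφ hDs hl => hlim.mem_of_tendsto hk hφ (fun t => (hmemA _ _).1 (hDs t)) hl)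
  have hmemJ : ∀ D, D ∈ 𝒥 ↔ D ∈ J k := fun D => by rw [← SetLike.mem_coe, h𝒥]
  have h𝒥hom : 𝒥 ≤ homogeneousSubmodule (Fin m × Fin m) ℂ k := fun D hD =>
    (mem_homogeneousSubmodule k D).2 (hlim.isHomogeneous_of_mem hk ((hmemJ D).1 hD))
  -- the filtration
  obtain ⟨S, hS⟩ := cr_exists_filt (σ := Fin m × Fin m) μ
  -- pinned ranks at `t = 0`
  have hrank : ∀ ν, Module.finrank ℂ ↥(𝒜 0 ⊓ S ν) = Module.finrank ℂ ↥(𝒥 ⊓ S ν) := by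
    intro ν
    have h := hrk ν
    have e1 : annihilatorOfDegree (P' 0) k ∩
        {D : MvPolynomial (Fin m × Fin m) ℂ | ∀ e ∈ D.support, ν ≤ Finsupp.weight μ e} =
        ((𝒜 0 ⊓ S ν : Submodule ℂ (MvPolynomial (Fin m × Fin m) ℂ)) : Set _) := by
      ext D
      simp only [Set.mem_inter_iff, Set.mem_setOf_eq, Submodule.coe_inf, SetLike.mem_coe, hmemA, hS]
    have e2 : J k ∩ {D : MvPolynomial (Fin m × Fin m) ℂ | ∀ e ∈ D.support, ν ≤ Finsupp.weight μ e} =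
        ((𝒥 ⊓ S ν : Submodule ℂ (MvPolynomial (Fin m × Fin m) ℂ)) : Set _) := by
      ext D
      simp only [Set.mem_inter_iff, Set.mem_setOf_eq, Submodule.coe_inf, SetLike.mem_coe, hmemJ, hS]
    rwa [e1, e2, Submodule.span_eq, Submodule.span_eq] at h
  -- Step 1: the graded pieces have pinned dimension
  haveI : Module.Finite ℂ (homogeneousSubmodule (Fin m × Fin m) ℂ k) :=
    Module.Finite.iff_fg.2 (homogeneousSubmodule_fg (Fin m × Fin m) ℂ k)
  have key : ∀ (ν : ℤ) (p : Submodule ℂ (MvPolynomial (Fin m × Fin m) ℂ)),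
      p ≤ homogeneousSubmodule (Fin m × Fin m) ℂ k →
      Module.finrank ℂ ↥(p.map (weightedHomogeneousComponent μ ν)) +
        Module.finrank ℂ ↥(p ⊓ LinearMap.ker (weightedHomogeneousComponent μ ν)) =
        Module.finrank ℂ ↥p := by
    intro ν p hp
    haveI : FiniteDimensional ℂ p := Submodule.finiteDimensional_of_le hp
    rw [← LinearMap.range_domRestrict, ← Submodule.map_comap_subtype,
      Submodule.finrank_map_subtype_eq, ← LinearMap.ker_domRestrict]
    exact LinearMap.finrank_range_add_finrank_ker _
  have hdimI : ∀ ν, Module.finrank ℂ ↥((𝒜 0 ⊓ S ν).map (weightedHomogeneousComponent μ ν)) =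
      Module.finrank ℂ ↥((𝒥 ⊓ S ν).map (weightedHomogeneousComponent μ ν)) := by
    intro ν
    have h1 := key ν (𝒜 0 ⊓ S ν) (inf_le_left.trans (h𝒜hom 0))
    have h2 := key ν (𝒥 ⊓ S ν) (inf_le_left.trans h𝒥hom)
    rw [inf_assoc, cr_filt_inf_ker hS] at h1 h2
    have h3 := hrank ν
    have h4 := hrank (ν + 1)
    omega
  -- Step 2: the graded pieces coincide, being equidimensional subspaces of the space of degree-`k`
  -- forms of weight `ν`, which has dimension `≤ 1` by (TOT)
  have heq : ∀ ν, (𝒜 0 ⊓ S ν).map (weightedHomogeneousComponent μ ν) =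
      (𝒥 ⊓ S ν).map (weightedHomogeneousComponent μ ν) := by
    intro ν
    obtain ⟨v, hv⟩ := cci_exists_gen μ k htot ν
    have hle : ∀ p : Submodule ℂ (MvPolynomial (Fin m × Fin m) ℂ),
        p ≤ homogeneousSubmodule (Fin m × Fin m) ℂ k →
        (p ⊓ S ν).map (weightedHomogeneousComponent μ ν) ≤ ℂ ∙ v := by
      intro p hp
      refine Submodule.map_le_iff_le_comap.2 fun E hE => ?_
      obtain ⟨c, hc⟩ := hv _ ((mem_homogeneousSubmodule k _).1
        (cr_comp_mem_homogeneousSubmodule ν (hp (Submodule.mem_inf.1 hE).1)))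
        (weightedHomogeneousComponent_isWeightedHomogeneous ν E)
      rw [Submodule.mem_comap, hc]
      exact Submodule.smul_mem _ c (Submodule.mem_span_singleton_self v)
    haveI : FiniteDimensional ℂ (ℂ ∙ v) := FiniteDimensional.span_singleton ℂ v
    exact cci_eq_of_finrank_eq (hle _ (h𝒜hom 0)) (hle _ h𝒥hom)
      ((finrank_span_le_card ({v} : Set (MvPolynomial (Fin m × Fin m) ℂ))).trans (by simp))
      (hdimI ν)
  -- Step 3: assemble.  The graded pieces of `A` sit inside the initial span ...
  have hIN : ∀ ν, (𝒜 0 ⊓ S ν).map (weightedHomogeneousComponent μ ν) ≤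
      Submodule.span ℂ {D' : MvPolynomial (Fin m × Fin m) ℂ |
        ∃ E ∈ annihilatorOfDegree (P' 0) k, ∃ ν : ℤ, D' = weightedHomogeneousComponent μ ν E ∧
          ∀ ν' : ℤ, ν' < ν → weightedHomogeneousComponent μ ν' E = 0} := by
    intro ν
    refine Submodule.map_le_iff_le_comap.2 fun E hE => ?_
    obtain ⟨hEA, hES⟩ := Submodule.mem_inf.1 hE
    exact Submodule.subset_span ⟨E, (hmemA 0 E).1 hEA, ν, rfl,
      fun ν' hν' => cr_comp_eq_zero_of_mem_filt hS hES hν'⟩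
  -- ... the graded pieces of `J k` exhaust `J k` and lie in `J k`
  have hπN : ∀ ν : ℤ, ∀ D ∈ 𝒥,
      weightedHomogeneousComponent μ ν D ∈ (𝒥 ⊓ S ν).map (weightedHomogeneousComponent μ ν) := by
    intro ν D hD
    refine Submodule.mem_map.2 ⟨weightedHomogeneousComponent μ ν D, Submodule.mem_inf.2
      ⟨(hmemJ _).2 (hgr D ((hmemJ D).1 hD) ν), cr_comp_mem_filt hS ν D⟩, ?_⟩
    rw [weightedHomogeneousComponent_of_mem (weightedHomogeneousComponent_mem μ D ν), if_pos rfl]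
  have hN𝒥 : ∀ ν : ℤ, (𝒥 ⊓ S ν).map (weightedHomogeneousComponent μ ν) ≤ 𝒥 := fun ν =>
    Submodule.map_le_iff_le_comap.2 fun D hD =>
      (hmemJ _).2 (hgr D ((hmemJ D).1 (Submodule.mem_inf.1 hD).1) ν)
  constructor
  · intro hDJ
    rw [← cr_sum_comp (μ := μ) D]
    refine Submodule.sum_mem _ fun ν _ => hIN ν ?_
    rw [heq ν]
    exact hπN ν D ((hmemJ D).2 hDJ)
  · intro hD
    rw [← hmemJ]
    refine (Submodule.span_le.2 ?_) hD
    rintro _ ⟨E, hE, ν₀, rfl, hlow⟩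
    refine hN𝒥 ν₀ ?_
    rw [← heq ν₀]
    exact Submodule.mem_map_of_mem
      (Submodule.mem_inf.2 ⟨(hmemA 0 E).2 hE, cr_mem_filt_of_comp_eq_zero hS hlow⟩)

end Main

/-! ## The stub -/

section Stub

open MvPolynomial Filter
open scoped Matrix BigOperators
open Literature.Computability.AlgebraicComplexity

/-- **S4 at isolated fixed points — a fixed point approached inside its own Białynicki-Birula cell
is toric.**  If `P'_t ∈ GL_{m²} · det_m`, `Ann_•(P'_t) → J` degree-wise (`k ≤ m`), `J` is
`μ`-graded, `μ` is a total order on the degree-`k` exponents (`k ≤ m`; distinct exponents have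
distinct `μ`-weights — genericity of `μ` at an ISOLATED torus-fixed point), and the `μ`-filtration
ranks `dim span(Ann_k(P'_t) ∩ S_{≥ν})` equal those of `J k`, then `J` is toric: with `u = 1`,
`g ∈ GL` such that `P'_0 = g · det_m`, and `w = μ`, for all `k ≤ m`,
`J k = {D | uᵀ · D ∈ in_w(Ann_k(g · det_m))} = in_μ(Ann_k(P'_0))`, the span of the lowest-`μ`-weight
forms — degree by degree `cci_core`: the graded pieces `π_ν(Ann_k(P'_0) ∩ S_{≥ν})` and
`π_ν(J k ∩ S_{≥ν})` are equidimensional subspaces of the `≤ 1`-dimensional space of degree-`k`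
forms of weight `ν`, hence equal, and both sides are the sums of their graded pieces. [folklore] -/
theorem stub_cellClosure_isolated :
    ∀ (m : ℕ) (J : ℕ → Set (MvPolynomial (Fin m × Fin m) ℂ)) (μ : Fin m × Fin m → ℤ)
      (P' : ℕ → MvPolynomial (Fin m × Fin m) ℂ),
      (∀ k ≤ m, ∀ e e' : (Fin m × Fin m) →₀ ℕ, e.degree = k → e'.degree = k → e ≠ e' →
        Finsupp.weight μ e ≠ Finsupp.weight μ e') →
      (∀ t : ℕ, P' t ∈ glOrbit (Fin m × Fin m) ℂ (detPoly (Fin m) ℂ)) →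
      IsBorderApolarLimit m P' J →
      (∀ k ≤ m, ∀ D ∈ J k, ∀ ν : ℤ, weightedHomogeneousComponent μ ν D ∈ J k) →
      (∀ t : ℕ, ∀ k ≤ m, ∀ ν : ℤ,
        Module.finrank ℂ ↥(Submodule.span ℂ (annihilatorOfDegree (P' t) k ∩
          {D : MvPolynomial (Fin m × Fin m) ℂ | ∀ e ∈ D.support, ν ≤ Finsupp.weight μ e})) =
        Module.finrank ℂ ↥(Submodule.span ℂ (J k ∩
          {D : MvPolynomial (Fin m × Fin m) ℂ | ∀ e ∈ D.support, ν ≤ Finsupp.weight μ e}))) →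
      ∃ (u g : Matrix.GeneralLinearGroup (Fin m × Fin m) ℂ) (w : Fin m × Fin m → ℤ),
        ∀ k ≤ m, ∀ D : MvPolynomial (Fin m × Fin m) ℂ,
          D ∈ J k ↔ linSubst (Fin m × Fin m) ℂ (u : Matrix (Fin m × Fin m) (Fin m × Fin m) ℂ)ᵀ D ∈
            Submodule.span ℂ {D' : MvPolynomial (Fin m × Fin m) ℂ |
              ∃ E ∈ annihilatorOfDegree (linSubst (Fin m × Fin m) ℂ
                (g : Matrix (Fin m × Fin m) (Fin m × Fin m) ℂ) (detPoly (Fin m) ℂ)) k, ∃ ν : ℤ,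
                D' = weightedHomogeneousComponent w ν E ∧
                  ∀ ν' : ℤ, ν' < ν → weightedHomogeneousComponent w ν' E = 0} := by
  intro m J μ P' htot horb hlim hgr hrk
  obtain ⟨g, hg⟩ := horb 0
  simp only [linSubstRep_apply] at hg
  refine ⟨1, g, μ, fun k hk D => ?_⟩
  rw [hg, Units.val_one, Matrix.transpose_one, linSubst_one, AlgHom.id_apply]
  exact cci_core m J μ P' k hk (htot k hk) hlim (hgr k hk) (fun ν => hrk 0 k hk ν) D

end Stub

end Summit.ValiantsHypothesis.ValiantsHypothesis.Theorems.BorderApolarityToricFixedPoints
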